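import Summits.SmoothPoincare4.SmoothPoincare4.Theses.ExoticMirrors
import HarnessLib

/-!
# Line `birth` — BC3 skeleton for the crux `ExoticMirrors.MirrorNonnegCurvature` (stmt-SmoothPoincare4-5633)

Route `route-SmoothPoincare4-ExoticMirrors` ("fake 4-spheres are mirrors of `S⁵` that repel
nonnegative curvature"), crux rank 3, decl
`Summit.SmoothPoincare4.SmoothPoincare4.Theses.ExoticMirrors.MirrorNonnegCurvature` = the route's
thesis X itself (MIRROR-NONNEG):

  for every smooth involution `τ` of the standard `S⁵ ⊂ ℝ⁶` and every closed smooth `M ≃ₕ S⁴`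
  smoothly embedded onto `Fix τ` (a MIRROR of a homotopy 4-sphere), `S⁵` carries a `τ`-invariant
  `C^∞` Riemannian metric with `Rm(X,Y,Y,X) ≥ 0` for every Levi-Civita connection (sec ≥ 0).

Standing of the crux (item notes, grounder g13-25 and refuter dc227247, 2026-08-15): OPEN and
SPC4-COMPLETE with zero slack — `SPC4 ⇒ X` ("`M ≅ S⁴` ⇒ `Fix τ` is a smooth `S⁴ ⊂ S⁵` ⇒ bounds
5-discs on both sides ⇒ `τ` is conjugate to the linear reflection ⇒ transport the round metric",
refuter note) and `X ∧ ReflectionSoulRigidity ∧ MirrorRealisation ⇒ SPC4` (the route's `closes`).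
No `Disproof.lean`, no `Lines/*`, no crux ideas, no landed `Theorems/MirrorNonnegCurvature/Negative/*`
(`ledger crux ls stmt-SmoothPoincare4-5633`: no workfiles, 2026-08-17); `ledger negatives --problem
SmoothPoincare4`: 0 refuted statements. This file is the crux's BIRTH CERTIFICATE skeleton
(LENSES-v3 §2 BC3; registrar seat `planner-skel-stmt-SmoothPoincare4-5633-0`, 2026-08-17).

## The line: LINEARISE THE MIRROR, THEN TRANSPORT THE ROUND METRIC

The only known mechanism producing an invariant metric of nonnegative sectional curvature on
`(S⁵, τ)` is the one behind `SPC4 ⇒ X`: conjugate `τ` into the orthogonal group and pull the round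
metric back along the conjugating diffeomorphism. Typed over the tree this is three NAMED pieces —
one open core about the SYMMETRY (where all of the crux's difficulty provably sits, by
`ReflectionSoulRigidity`) and two genuine library lemmas of Riemannian geometry that the tree does
not yet have:

* `stub_mirrorLinearisable` (L — OPEN, the hard stub; SPC4-strength): every mirror involution of a
  homotopy 4-sphere is SMOOTHLY LINEARISABLE — there are a diffeomorphism `φ` of `S⁵` and a linear
  isometry `A ∈ O(6)` with `φ ∘ τ = A ∘ φ` on `S⁵` (so `φ τ φ⁻¹ = A|_{S⁵}`, necessarily a hyperplane
  reflection). This is the de Rham–Smith linearisation problem for reflections of `S⁵` restricted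
  to mirrors of homotopy 4-spheres (for arbitrary smooth reflections it is FALSE: the Kervaire
  mirrors with `π₁(Fix) = SL(2,5)`, route support `KervaireMirror`; the restriction to `M ≃ₕ S⁴` is
  exactly what keeps the stub alive). Known reductions: if `M ≅ S⁴` then both closed complementary
  domains are compact contractible 5-manifolds with boundary `S⁴`, hence 5-discs (`Θ₅ = 0` +
  Smale's h-cobordism theorem in dimension 6 + Palais–Cerf disc theorem), `τ` swaps them
  (`dτ = −1` on the normal line of the 4-dimensional fixed set), and an equivariant collar makes the
  obvious conjugation smooth; conversely L gives `M ≅ Fix A ∩ S⁵ ≅ S⁴`. So L ⇔ (SPC4 for mirrors)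
  ⇔ SPC4 (with `MirrorRealisation`). Why it might fail: an exotic mirror exists iff SPC4 fails.
  Sources: Schultz1982 (exotic spheres as stationary sets / nonlinear reflections),
  KervaireMilnorAnnals1963 (`Θ₅ = 0`), Smale1962, Kervaire1969; FangGrove2016 §1 (reflection
  groups in nonnegative curvature: the chamber picture this linearisation trivialises).
* `stub_roundSphereFive_secNonneg_orthogonalInvariant` (R — KNOWN, tree-near, size S–M): the round
  metric of `S⁵ ⊂ ℝ⁶` (`Literature.Geometry.Riemannian.roundMetric`, a real definition) has
  `Rm(X,Y,Y,X) ≥ 0` for every Levi-Civita connection (tree THEOREM `curvature_roundMetric`: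
  `R(X,Y)Z = g(Y,Z)X − g(X,Z)Y`, so `Rm(X,Y,Y,X) = g(X,X)g(Y,Y) − g(X,Y)² ≥ 0` by Cauchy–Schwarz),
  and every diffeomorphism of `S⁵` that is the restriction of a linear isometry of `ℝ⁶` is an
  isometry of it (tree THEOREM `comap_sphereMap_roundMetric` / `val_mfderiv_sphereMap`, Lee 2018
  Problem 5-11, read through `PseudoRiemannianMetric.IsIsometry`). Why it might fail: it does not;
  it is the model computation of the line, to be landed as two small `Literature` lemmas.
* `stub_secNonneg_transport` (T — KNOWN, missing infrastructure, size L): NATURALITY of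
  "Riemannian with sec ≥ 0" and of isometries under a diffeomorphism `φ` of `S⁵`: the pullback
  `g' = φ^* g` (`PseudoRiemannianMetric.comap`, smoothness by the PROVED
  `contMDiff_pullbackBilin_holds`) is Riemannian, has `Rm' ≥ 0` on 2-planes for EVERY Levi-Civita
  connection of `g'` (push a Levi-Civita connection of `g'` forward along `φ`: it is Levi-Civita
  for `g`, and the (0,4)-curvature tensor is natural — O'Neill 1983 Ch. 3, Prop. 3.59 ff.; Lee 2018
  Prop. 5.13 / Lemma 7.? ("local isometry invariance of `Rm`")), and conjugation `σ ↦ φ⁻¹ σ φ`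
  carries `g`-isometries to `g'`-isometries (chain rule `pullbackBilin_comp`, PROVED). The tree has
  the pullback METRIC but no pushforward/pullback of COVARIANT DERIVATIVES nor the naturality of
  `CovariantDerivative.curvature`; that is the work. Why it might fail: it does not (textbook);
  Lean-level risk only (junk values of Mathlib covariant derivatives on non-differentiable sections —
  the statement quantifies over Levi-Civita connections exactly as the crux does, so the junk is
  harmless: curvature is evaluated through `CovariantDerivative.curvature`, a tensor).

* `mirrorNonnegCurvature_of_stubSigs : L-sig → R-sig → T-sig → (body of the crux)` — the REAL
  composition (sorry-free): given a mirror `(τ, M, e)`, L gives `(φ, A)`; the conjugate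
  `σ = φ τ φ⁻¹` satisfies `σ x = A x`, so R makes it an isometry of `g_round`; T applied to `φ`
  and `g_round` gives `g' = φ^* g_round`, Riemannian with `Rm' ≥ 0`, invariant under
  `φ⁻¹ σ φ = τ` (`Diffeomorph.ext`).
* `MirrorNonnegCurvature_of : MirrorNonnegCurvature` — THE skeleton theorem: the crux BY NAME from
  the three declared stubs (the file's only theorem whose head is the crux; `sorry` occurs ONLY in
  the three `stub_*` bodies).

Honest accounting (BC3 is a certificate of shape, not of progress): the crux has zero slack, so any
exact split has an SPC4-strength piece; this split puts it in ONE NAMED, classical statement about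
a `ℤ/2`-symmetry of a KNOWN manifold (the route's own philosophy: "move the unknown from a manifold
to a symmetry"), and isolates as separate provable obligations the two pieces of Riemannian-geometry
infrastructure (`R`, `T`) that every curvature line on this route (`MirrorScalarCurvature`,
`MirrorRigidityPCO`, `ReflectionSoulRigidity`'s "transport the round metric" direction) will need.
Converse bookkeeping: `X ⇒ L` is `ReflectionSoulRigidity` + the disc argument (not claimed here).

BC3 probes (planner folder `bc/probe_{L,R,T}_{crux,summit}.lean`, farm `lean check`, 2026-08-17;
table in `Lines/birth.md`): for each stub S ∈ {L, R, T} and each target ∈ {`MirrorNonnegCurvature`,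
`SmoothPoincare4`}, nine separate examples `S-sig → target` — `exact?`, `simpa`,
`simpa [S, target]`, `unfold …; simpa`, `aesop`, `unfold …; aesop` on a `def`-wrapped signature,
and `exact?`, `simpa`, `aesop` on the literal signature — each under its own
`maxHeartbeats 400000`: ALL 54 FAIL (rc 1 each file; `exact?` "could not close the goal",
`simpa` "Tactic `assumption` failed", `aesop` "failed to prove the goal after exhaustive search").
No stub is cheaply the crux or the summit. Disproof used: none exists for this crux. Negatives
index: empty.
-/

noncomputable section

-- the prescribed namespace `Summit.<P>.<Sub>.…` duplicates `SmoothPoincare4` (P = Sub)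
set_option linter.dupNamespace false
set_option linter.unusedVariables false

open scoped Manifold ContDiff Topology ContinuousMap
open Literature.Geometry.Lorentzian (PseudoRiemannianMetric)
open Literature.Geometry.Lorentzian.PseudoRiemannianMetric (IsIsometry)
open Summit.SmoothPoincare4.SmoothPoincare4.Theses.ExoticMirrors (MirrorNonnegCurvature)

namespace Summit.SmoothPoincare4.SmoothPoincare4.Cruxes.MirrorNonnegCurvature.Birth

/-- Local notation: the standard `S⁵ ⊂ ℝ⁶` (the ambient sphere of the route). -/
local notation "𝕊⁵" => (Metric.sphere (0 : EuclideanSpace ℝ (Fin 6)) 1)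
/-- Local notation: the standard `S⁴ ⊂ ℝ⁵` (the comparison sphere of `SmoothPoincare4`). -/
local notation "𝕊⁴" => (Metric.sphere (0 : EuclideanSpace ℝ (Fin 5)) 1)
/-- Local notation: the ambient Euclidean space `ℝ⁶`. -/
local notation "ℝ⁶" => EuclideanSpace ℝ (Fin 6)

/-! ## The three registered stubs (`sorry` lives ONLY here) -/

/-- **Stub L (OPEN — the hard stub): mirrors of homotopy 4-spheres are smoothly linearisable.**
For every smooth involution `τ` of `S⁵` whose fixed-point set is the image of a smooth embedding of
a closed smooth 4-manifold `M ≃ₕ S⁴` (the hypotheses of the crux, verbatim), there are a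
diffeomorphism `φ : S⁵ ≃ S⁵` and a linear isometry `A` of `ℝ⁶` with `φ (τ x) = A (φ x)` for all
`x ∈ S⁵`, i.e. `φ τ φ⁻¹` is the restriction of an orthogonal map (then automatically a hyperplane
reflection). Equivalent to SPC4 for mirrors (both complementary domains of a smooth `S⁴ ⊂ S⁵` are
5-discs by `Θ₅ = 0`, the h-cobordism theorem in dimension 6 and the disc theorem, and `τ` swaps
them; conversely `M ≅ Fix A ∩ S⁵ = S⁴`); FALSE for arbitrary smooth reflections of `S⁵` (Kervaire
mirrors, route support `KervaireMirror`) — the restriction to `M ≃ₕ S⁴` is load-bearing.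
Why it might fail: an exotic mirror exists iff SPC4 fails (the crux's own, zero-slack risk).
[cite: Schultz1982] [cite: KervaireMilnorAnnals1963] [cite: Smale1962] [cite: FangGrove2016, §1] -/
theorem stub_mirrorLinearisable :
    ∀ (τ : (Metric.sphere (0 : EuclideanSpace ℝ (Fin 6)) 1) ≃ₘ⟮𝓡 5, 𝓡 5⟯
        (Metric.sphere (0 : EuclideanSpace ℝ (Fin 6)) 1)), (∀ x, τ (τ x) = x) →
      ∀ (M : Type) [TopologicalSpace M] [T2Space M] [SecondCountableTopology M] [CompactSpace M]
        [ChartedSpace (EuclideanSpace ℝ (Fin 4)) M] [IsManifold (𝓡 4) ∞ M],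
        M ≃ₕ Metric.sphere (0 : EuclideanSpace ℝ (Fin 5)) 1 →
          ∀ (e : M → Metric.sphere (0 : EuclideanSpace ℝ (Fin 6)) 1),
            Manifold.IsSmoothEmbedding (𝓡 4) (𝓡 5) ∞ e → Set.range e = Function.fixedPoints τ →
              ∃ (φ : (Metric.sphere (0 : EuclideanSpace ℝ (Fin 6)) 1) ≃ₘ⟮𝓡 5, 𝓡 5⟯
                  (Metric.sphere (0 : EuclideanSpace ℝ (Fin 6)) 1))
                (A : EuclideanSpace ℝ (Fin 6) ≃ₗᵢ[ℝ] EuclideanSpace ℝ (Fin 6)),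
                ∀ x : Metric.sphere (0 : EuclideanSpace ℝ (Fin 6)) 1,
                  ((φ (τ x) : Metric.sphere (0 : EuclideanSpace ℝ (Fin 6)) 1) :
                      EuclideanSpace ℝ (Fin 6)) =
                    A ((φ x : Metric.sphere (0 : EuclideanSpace ℝ (Fin 6)) 1) :
                      EuclideanSpace ℝ (Fin 6)) := by
  sorry

/-- **Stub R (KNOWN, tree-near): the round `S⁵` — a Riemannian metric on `S⁵` with `sec ≥ 0`
for which `O(6)` acts by isometries.** There is a `C^∞` Riemannian metric `g` on the standard
`S⁵ ⊂ ℝ⁶` with `Rm(X,Y,Y,X) = g(R(X,Y)Y, X) ≥ 0` for every Levi-Civita connection and such that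
every diffeomorphism `σ` of `S⁵` that is the restriction of a linear isometry `A` of `ℝ⁶`
(`σ x = A x` as vectors) is a `g`-isometry. Witness: the round metric
`Literature.Geometry.Riemannian.roundMetric (EuclideanSpace ℝ (Fin 6))` (real definition,
`RoundSphere.lean`; Riemannian by `isRiemannian_roundMetric`): (i) by the tree THEOREM
`curvature_roundMetric` (`R(X,Y)Z = g(Y,Z)X − g(X,Z)Y`, Lee 2018 Thm. 8.34(b)/Prop. 8.36)
`Rm(X,Y,Y,X) = g(X,X)g(Y,Y) − g(X,Y)² ≥ 0` (Cauchy–Schwarz, via `roundMetric_val_eq_inner`);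
(ii) `σ = sphereMap A` as functions and the tree THEOREMS `val_mfderiv_sphereMap` /
`comap_sphereMap_roundMetric` (Lee 2018 Problem 5-11) give `σ^* g = g`, i.e.
`PseudoRiemannianMetric.IsIsometry g g σ`. Why it might fail: it does not (size S–M over the tree;
the `Fact (finrank ℝ ℝ⁶ = 5 + 1)` instance is Mathlib's scoped `EuclideanSpace` one).
[cite: Lee2018, Thm. 8.34, Prop. 8.36, Problem 5-11] [cite: ONeill1983, Ch. 3, Def. 3.4 and p. 57] -/
theorem stub_roundSphereFive_secNonneg_orthogonalInvariant :
    ∃ g : PseudoRiemannianMetric (𝓡 5) ∞ (EuclideanSpace ℝ (Fin 5))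
        (TangentSpace (𝓡 5) : Metric.sphere (0 : EuclideanSpace ℝ (Fin 6)) 1 → Type _),
      g.IsRiemannian ∧
        (∀ cov, g.IsLeviCivita cov →
            ∀ (x : Metric.sphere (0 : EuclideanSpace ℝ (Fin 6)) 1) (X Y : TangentSpace (𝓡 5) x),
              0 ≤ g.curvatureForm cov x X Y Y X) ∧
          ∀ (σ : (Metric.sphere (0 : EuclideanSpace ℝ (Fin 6)) 1) ≃ₘ⟮𝓡 5, 𝓡 5⟯
              (Metric.sphere (0 : EuclideanSpace ℝ (Fin 6)) 1))
            (A : EuclideanSpace ℝ (Fin 6) ≃ₗᵢ[ℝ] EuclideanSpace ℝ (Fin 6)),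
            (∀ x : Metric.sphere (0 : EuclideanSpace ℝ (Fin 6)) 1,
                ((σ x : Metric.sphere (0 : EuclideanSpace ℝ (Fin 6)) 1) : EuclideanSpace ℝ (Fin 6)) =
                  A (x : EuclideanSpace ℝ (Fin 6))) →
              Literature.Geometry.Lorentzian.PseudoRiemannianMetric.IsIsometry g g σ := by
  sorry

/-- **Stub T (KNOWN, missing infrastructure): transport of `sec ≥ 0` and of isometries along a
diffeomorphism.** For every diffeomorphism `φ` of `S⁵` and every `C^∞` Riemannian metric `g` on
`S⁵` with `Rm(X,Y,Y,X) ≥ 0` for every Levi-Civita connection, there is a `C^∞` Riemannian metric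
`g'` on `S⁵` (the pullback `φ^* g`, `PseudoRiemannianMetric.comap`, smooth by
`contMDiff_pullbackBilin_holds`) with `Rm'(X,Y,Y,X) ≥ 0` for every Levi-Civita connection of `g'`
(pushforward of a Levi-Civita connection of `φ^* g` is Levi-Civita for `g`; naturality of the
curvature tensor, O'Neill 1983 Ch. 3, Prop. 3.59 ff.) such that conjugation by `φ` carries
`g`-isometries to `g'`-isometries: `σ` a `g`-isometry ⇒ `φ⁻¹ ∘ σ ∘ φ = φ.trans (σ.trans φ.symm)`
a `g'`-isometry (chain rule `pullbackBilin_comp`). Why it might fail: it does not (textbook); the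
tree lacks pushforward connections and the naturality of `CovariantDerivative.curvature` (size L).
[cite: ONeill1983, Ch. 3, Def. 3.9, p. 58, pp. 90–91, Prop. 3.59] -/
theorem stub_secNonneg_transport :
    ∀ (φ : (Metric.sphere (0 : EuclideanSpace ℝ (Fin 6)) 1) ≃ₘ⟮𝓡 5, 𝓡 5⟯
        (Metric.sphere (0 : EuclideanSpace ℝ (Fin 6)) 1))
      (g : PseudoRiemannianMetric (𝓡 5) ∞ (EuclideanSpace ℝ (Fin 5))
        (TangentSpace (𝓡 5) : Metric.sphere (0 : EuclideanSpace ℝ (Fin 6)) 1 → Type _)),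
      g.IsRiemannian →
        (∀ cov, g.IsLeviCivita cov →
            ∀ (x : Metric.sphere (0 : EuclideanSpace ℝ (Fin 6)) 1) (X Y : TangentSpace (𝓡 5) x),
              0 ≤ g.curvatureForm cov x X Y Y X) →
          ∃ g' : PseudoRiemannianMetric (𝓡 5) ∞ (EuclideanSpace ℝ (Fin 5))
              (TangentSpace (𝓡 5) : Metric.sphere (0 : EuclideanSpace ℝ (Fin 6)) 1 → Type _),
            g'.IsRiemannian ∧
              (∀ cov', g'.IsLeviCivita cov' →
                  ∀ (x : Metric.sphere (0 : EuclideanSpace ℝ (Fin 6)) 1)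
                    (X Y : TangentSpace (𝓡 5) x), 0 ≤ g'.curvatureForm cov' x X Y Y X) ∧
                ∀ σ : (Metric.sphere (0 : EuclideanSpace ℝ (Fin 6)) 1) ≃ₘ⟮𝓡 5, 𝓡 5⟯
                    (Metric.sphere (0 : EuclideanSpace ℝ (Fin 6)) 1),
                  Literature.Geometry.Lorentzian.PseudoRiemannianMetric.IsIsometry g g σ →
                    Literature.Geometry.Lorentzian.PseudoRiemannianMetric.IsIsometry g' g'
                      (φ.trans (σ.trans φ.symm)) := by
  sorry

/-! ## The composition: the three stubs prove the crux BY NAME (no `sorry` below this line) -/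

/-- **Composition with explicit hypotheses** (`L-sig → R-sig → T-sig → body of the crux`):
linearise the mirror (`φ ∘ τ = A ∘ φ`), observe that the conjugate `σ = φ τ φ⁻¹` is the
restriction of `A`, hence an isometry of the round metric (R), and transport the round metric along
`φ` (T): `g' = φ^* g_round` is Riemannian with `Rm' ≥ 0` and invariant under `φ⁻¹ σ φ = τ`.
This is the refuter's `SPC4 ⇒ X` argument with `SPC4` replaced by its symmetry form L.
[cite: Schultz1982] [cite: FangGrove2016, §1] -/
theorem mirrorNonnegCurvature_of_stubSigs
    (hL : ∀ (τ : 𝕊⁵ ≃ₘ⟮𝓡 5, 𝓡 5⟯ 𝕊⁵), (∀ x, τ (τ x) = x) →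
      ∀ (M : Type) [TopologicalSpace M] [T2Space M] [SecondCountableTopology M] [CompactSpace M]
        [ChartedSpace (EuclideanSpace ℝ (Fin 4)) M] [IsManifold (𝓡 4) ∞ M],
        M ≃ₕ 𝕊⁴ → ∀ (e : M → 𝕊⁵), Manifold.IsSmoothEmbedding (𝓡 4) (𝓡 5) ∞ e →
          Set.range e = Function.fixedPoints τ →
            ∃ (φ : 𝕊⁵ ≃ₘ⟮𝓡 5, 𝓡 5⟯ 𝕊⁵) (A : ℝ⁶ ≃ₗᵢ[ℝ] ℝ⁶),
              ∀ x : 𝕊⁵, ((φ (τ x) : 𝕊⁵) : ℝ⁶) = A ((φ x : 𝕊⁵) : ℝ⁶))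
    (hR : ∃ g : PseudoRiemannianMetric (𝓡 5) ∞ (EuclideanSpace ℝ (Fin 5))
        (TangentSpace (𝓡 5) : 𝕊⁵ → Type _),
      g.IsRiemannian ∧
        (∀ cov, g.IsLeviCivita cov → ∀ (x : 𝕊⁵) (X Y : TangentSpace (𝓡 5) x),
            0 ≤ g.curvatureForm cov x X Y Y X) ∧
          ∀ (σ : 𝕊⁵ ≃ₘ⟮𝓡 5, 𝓡 5⟯ 𝕊⁵) (A : ℝ⁶ ≃ₗᵢ[ℝ] ℝ⁶),
            (∀ x : 𝕊⁵, ((σ x : 𝕊⁵) : ℝ⁶) = A (x : ℝ⁶)) →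
              Literature.Geometry.Lorentzian.PseudoRiemannianMetric.IsIsometry g g σ)
    (hT : ∀ (φ : 𝕊⁵ ≃ₘ⟮𝓡 5, 𝓡 5⟯ 𝕊⁵)
      (g : PseudoRiemannianMetric (𝓡 5) ∞ (EuclideanSpace ℝ (Fin 5))
        (TangentSpace (𝓡 5) : 𝕊⁵ → Type _)),
      g.IsRiemannian →
        (∀ cov, g.IsLeviCivita cov → ∀ (x : 𝕊⁵) (X Y : TangentSpace (𝓡 5) x),
            0 ≤ g.curvatureForm cov x X Y Y X) →
          ∃ g' : PseudoRiemannianMetric (𝓡 5) ∞ (EuclideanSpace ℝ (Fin 5))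
              (TangentSpace (𝓡 5) : 𝕊⁵ → Type _),
            g'.IsRiemannian ∧
              (∀ cov', g'.IsLeviCivita cov' → ∀ (x : 𝕊⁵) (X Y : TangentSpace (𝓡 5) x),
                  0 ≤ g'.curvatureForm cov' x X Y Y X) ∧
                ∀ σ : 𝕊⁵ ≃ₘ⟮𝓡 5, 𝓡 5⟯ 𝕊⁵,
                  Literature.Geometry.Lorentzian.PseudoRiemannianMetric.IsIsometry g g σ →
                    Literature.Geometry.Lorentzian.PseudoRiemannianMetric.IsIsometry g' g'
                      (φ.trans (σ.trans φ.symm))) :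
    ∀ (τ : 𝕊⁵ ≃ₘ⟮𝓡 5, 𝓡 5⟯ 𝕊⁵), (∀ x, τ (τ x) = x) →
      ∀ (M : Type) [TopologicalSpace M] [T2Space M] [SecondCountableTopology M] [CompactSpace M]
        [ChartedSpace (EuclideanSpace ℝ (Fin 4)) M] [IsManifold (𝓡 4) ∞ M],
        M ≃ₕ 𝕊⁴ → ∀ (e : M → 𝕊⁵), Manifold.IsSmoothEmbedding (𝓡 4) (𝓡 5) ∞ e →
          Set.range e = Function.fixedPoints τ →
            ∃ g : PseudoRiemannianMetric (𝓡 5) ∞ (EuclideanSpace ℝ (Fin 5))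
                (TangentSpace (𝓡 5) : 𝕊⁵ → Type _),
              g.IsRiemannian ∧
                Literature.Geometry.Lorentzian.PseudoRiemannianMetric.IsIsometry g g τ ∧
                  ∀ cov, g.IsLeviCivita cov → ∀ (x : 𝕊⁵) (X Y : TangentSpace (𝓡 5) x),
                    0 ≤ g.curvatureForm cov x X Y Y X := by
  intro τ hτ M _ _ _ _ _ _ e e' he hfix
  -- L: linearise the mirror
  obtain ⟨φ, A, hconj⟩ := hL τ hτ M e e' he hfix
  -- R: the round metric `g₀` (sec ≥ 0, `O(6)`-invariant)
  obtain ⟨g₀, hg₀, hsec₀, hiso₀⟩ := hR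
  -- the conjugate `σ = φ τ φ⁻¹` is the restriction of `A` to `S⁵`
  have hσ : ∀ x : 𝕊⁵, (((φ.symm.trans (τ.trans φ)) x : 𝕊⁵) : ℝ⁶) = A (x : ℝ⁶) := by
    intro x
    simp only [Diffeomorph.coe_trans, Function.comp_apply]
    rw [hconj, Diffeomorph.apply_symm_apply]
  -- hence `σ` is a `g₀`-isometry
  have hiso : Literature.Geometry.Lorentzian.PseudoRiemannianMetric.IsIsometry g₀ g₀
      (φ.symm.trans (τ.trans φ)) :=
    hiso₀ _ A hσ
  -- T: transport `g₀` along `φ`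
  obtain ⟨g', hg', hsec', hconj'⟩ := hT φ g₀ hg₀ hsec₀
  refine ⟨g', hg', ?_, hsec'⟩
  have key := hconj' _ hiso
  -- `φ⁻¹ ∘ (φ τ φ⁻¹) ∘ φ = τ`
  have heq : φ.trans ((φ.symm.trans (τ.trans φ)).trans φ.symm) = τ := by
    refine Diffeomorph.ext fun x => ?_
    simp only [Diffeomorph.coe_trans, Function.comp_apply, Diffeomorph.symm_apply_apply]
  rw [heq] at key
  exact key

/-- **THE SKELETON THEOREM.** The crux
`Summit.SmoothPoincare4.SmoothPoincare4.Theses.ExoticMirrors.MirrorNonnegCurvature`, concluded BY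
NAME from the three DECLARED stubs `stub_mirrorLinearisable`,
`stub_roundSphereFive_secNonneg_orthogonalInvariant`, `stub_secNonneg_transport` (the only `sorry`s of
the file) through the sorry-free composition `mirrorNonnegCurvature_of_stubSigs`.
[cite: Schultz1982] [cite: FangGrove2016, §1] -/
theorem MirrorNonnegCurvature_of : MirrorNonnegCurvature :=
  mirrorNonnegCurvature_of_stubSigs stub_mirrorLinearisable
    stub_roundSphereFive_secNonneg_orthogonalInvariant stub_secNonneg_transport

end Summit.SmoothPoincare4.SmoothPoincare4.Cruxes.MirrorNonnegCurvature.Birth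

end
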